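import Mathlib.Topology.MetricSpace.ProperSpace
import Mathlib.Order.Filter.Ultrafilter.Basic
import Mathlib.Topology.Algebra.Order.Floor
import Mathlib.Analysis.SpecificLimits.Basic
import Mathlib.Topology.Sequences
import HarnessLib

/-!
# Menger's theorem: proper metric spaces with midpoints are geodesic

The metric form of Hopf–Rinow used silently for the limit spaces of Riemannian manifolds
(Huang–Huang–Wang–Zhu 2026, §4 p. 13: the pointed Gromov–Hausdorff limit `ℝˢ × Ŷ` of the covers
`M̂ᵢ` is treated as a geodesic space — "connect `y₁, y₂` by a geodesic `η`", p. 14): in a proper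
metric space in which every pair of points has a midpoint, every pair of points is joined by a
minimal segment (Menger's construction by dyadic midpoints; cf. O'Neill 1983, Ch. 5, Prop. 22 and
Lemma 24 and the tree's Riemannian `exists_isometric_segment_of_isCompact_closedBall`, of which this
is the metric-space generalisation), and approximate midpoints are as good as midpoints (properness).
Midpoints, unlike segments, visibly pass to Gromov–Hausdorff limits (`GeodesicGHLimits.lean`).

* `dist_eq_of_chain` — a chain `f 0 = x, …, f N = y` with gaps `≤ δ`, `N δ = d(x, y)`, realises
  the distances `d(f j, f k) = (k - j) δ`;
* `exists_midpoint_chain` — dyadic midpoint chains of every level;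
* `exists_midpoint_of_forall_approx` — **in a proper space approximate midpoints give a midpoint**;
* `exists_segment_of_exists_midpoint` — **Menger: proper + midpoints ⇒ geodesic** (a unit-speed
  minimal segment `σ`, `σ 0 = x`, `σ (d(x,y)) = y`, `d(σ s, σ t) = |s - t|` on `[0, d(x,y)]`);
* `exists_midpoint_of_segment` — conversely segments give midpoints.

Everything is proved; no definitions, no named facts.

## References

* B. O'Neill, *Semi-Riemannian Geometry* (1983), Ch. 5, Prop. 22 and Lemma 24. [ONeill1983]
* H. Huang, X.-T. Huang, J. Wang, X. Zhu, arXiv:2605.24380 (2026), §4 pp. 13–14. [HuangHuangWangZhu2026]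
-/

noncomputable section

open Set Filter Metric Topology

namespace Literature.Geometry.MetricGeometry

/-! ### §1. Chains realising the distance -/

section Chain

variable {X : Type*} [PseudoMetricSpace X]

/-- Along a chain with gaps `≤ δ`, `d(f j, f k) ≤ (k - j) δ` for `j ≤ k ≤ N`. [folklore] -/
theorem dist_le_of_chain {f : ℕ → X} {N : ℕ} {δ : ℝ}
    (hgap : ∀ k, k < N → dist (f k) (f (k + 1)) ≤ δ) {j k : ℕ} (hjk : j ≤ k) (hk : k ≤ N) :
    dist (f j) (f k) ≤ ((k - j : ℕ) : ℝ) * δ := by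
  induction k, hjk using Nat.le_induction with
  | base => simp
  | succ k hjk ih =>
    have hkN : k < N := hk
    calc dist (f j) (f (k + 1)) ≤ dist (f j) (f k) + dist (f k) (f (k + 1)) := dist_triangle _ _ _
      _ ≤ ((k - j : ℕ) : ℝ) * δ + δ := add_le_add (ih hkN.le) (hgap k hkN)
      _ = ((k + 1 - j : ℕ) : ℝ) * δ := by
        rw [show k + 1 - j = (k - j) + 1 by omega]
        push_cast
        ring

/-- **A chain with `N` gaps `≤ δ` between points at distance `N δ` realises all distances**:
`d(f j, f k) = (k - j) δ` for `j ≤ k ≤ N` (the triangle inequality along the chain gives `≤`, and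
`d(x, y) ≤ d(x, f j) + d(f j, f k) + d(f k, y) ≤ j δ + d(f j, f k) + (N - k) δ` gives `≥`).
[folklore] -/
theorem dist_eq_of_chain {x y : X} {N : ℕ} {δ : ℝ} (hδ : (N : ℝ) * δ = dist x y) {f : ℕ → X}
    (hf0 : f 0 = x) (hfN : f N = y) (hgap : ∀ k, k < N → dist (f k) (f (k + 1)) ≤ δ)
    {j k : ℕ} (hjk : j ≤ k) (hk : k ≤ N) :
    dist (f j) (f k) = ((k - j : ℕ) : ℝ) * δ := by
  refine le_antisymm (dist_le_of_chain hgap hjk hk) ?_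
  have h1 : dist x (f j) ≤ ((j - 0 : ℕ) : ℝ) * δ := by
    rw [← hf0]
    exact dist_le_of_chain hgap (Nat.zero_le j) (hjk.trans hk)
  have h2 : dist (f k) y ≤ ((N - k : ℕ) : ℝ) * δ := by
    rw [← hfN]
    exact dist_le_of_chain hgap hk le_rfl
  have h3 : dist x y ≤ dist x (f j) + dist (f j) (f k) + dist (f k) y := dist_triangle4 _ _ _ _
  rw [Nat.sub_zero] at h1
  have hcast : ((k - j : ℕ) : ℝ) = k - j := Nat.cast_sub hjk
  have hcast' : ((N - k : ℕ) : ℝ) = N - k := Nat.cast_sub hk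
  rw [hcast]
  rw [hcast'] at h2
  nlinarith

end Chain

/-! ### §2. Dyadic midpoint chains -/

section Midpoint

variable {X : Type*} [PseudoMetricSpace X]

/-- **Dyadic midpoint chains**: if every pair of points has a midpoint, for all `x, y, i` there is a
chain `f 0 = x, …, f (2^i) = y` with consecutive distances `≤ d(x, y)/2^i` (insert midpoints).
[cite: ONeill1983, Ch. 5, Lemma 24] -/
theorem exists_midpoint_chain
    (hmid : ∀ a b : X, ∃ m, dist a m = dist a b / 2 ∧ dist m b = dist a b / 2) (x y : X) (i : ℕ) :
    ∃ f : ℕ → X, f 0 = x ∧ f (2 ^ i) = y ∧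
      ∀ k, k < 2 ^ i → dist (f k) (f (k + 1)) ≤ dist x y / 2 ^ i := by
  induction i with
  | zero =>
    refine ⟨fun k ↦ if k = 0 then x else y, by simp, by simp, fun k hk ↦ ?_⟩
    have hk0 : k = 0 := by omega
    subst hk0
    simp
  | succ i ih =>
    obtain ⟨f, hf0, hf1, hgap⟩ := ih
    choose mid hmid₁ hmid₂ using hmid
    have hdiv : ∀ a : ℝ, a / 2 ^ i / 2 = a / 2 ^ (i + 1) := fun a ↦ by
      rw [pow_succ, div_div]
    refine ⟨fun k ↦ if Even k then f (k / 2) else mid (f (k / 2)) (f (k / 2 + 1)), ?_, ?_, ?_⟩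
    · simp [hf0]
    · have h2 : Even (2 ^ (i + 1)) := Nat.even_pow.2 ⟨even_two, Nat.succ_ne_zero i⟩
      have h3 : 2 ^ (i + 1) / 2 = 2 ^ i := by rw [pow_succ, Nat.mul_div_cancel _ two_pos]
      beta_reduce
      rw [if_pos h2, h3, hf1]
    · intro k hk
      rcases Nat.even_or_odd k with ⟨j, rfl⟩ | ⟨j, rfl⟩
      · have hj : j < 2 ^ i := by rw [pow_succ] at hk; omega
        have he : Even (j + j) := ⟨j, rfl⟩
        have ho : ¬ Even (j + j + 1) := Nat.not_even_iff_odd.2 ⟨j, by ring⟩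
        have h1 : (j + j) / 2 = j := by omega
        have h2 : (j + j + 1) / 2 = j := by omega
        simp only [he, ho, if_true, if_false, h1, h2]
        rw [hmid₁, ← hdiv]
        exact div_le_div_of_nonneg_right (hgap j hj) zero_le_two
      · have hj : j < 2 ^ i := by rw [pow_succ] at hk; omega
        have ho : ¬ Even (2 * j + 1) := Nat.not_even_iff_odd.2 ⟨j, rfl⟩
        have he : Even (2 * j + 1 + 1) := ⟨j + 1, by ring⟩
        have h1 : (2 * j + 1) / 2 = j := by omega
        have h2 : (2 * j + 1 + 1) / 2 = j + 1 := by omega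
        simp only [he, ho, if_true, if_false, h1, h2]
        rw [hmid₂, ← hdiv]
        exact div_le_div_of_nonneg_right (hgap j hj) zero_le_two

/-- Conversely, **segments give midpoints**: `σ (d/2)` for a unit-speed segment from `x` to `y`.
[folklore] -/
theorem exists_midpoint_of_segment {x y : X} {σ : ℝ → X} (h0 : σ 0 = x) (h1 : σ (dist x y) = y)
    (hσ : ∀ s ∈ Icc 0 (dist x y), ∀ t ∈ Icc 0 (dist x y), dist (σ s) (σ t) = |s - t|) :
    ∃ m, dist x m = dist x y / 2 ∧ dist m y = dist x y / 2 := by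
  have hd : 0 ≤ dist x y := dist_nonneg
  have hm : dist x y / 2 ∈ Icc 0 (dist x y) := ⟨by positivity, by linarith⟩
  refine ⟨σ (dist x y / 2), ?_, ?_⟩
  · have := hσ 0 ⟨le_rfl, hd⟩ _ hm
    rw [h0, zero_sub, abs_neg, abs_of_nonneg (by positivity)] at this
    exact this
  · have := hσ _ hm _ ⟨hd, le_rfl⟩
    rw [h1, abs_of_nonpos (by linarith)] at this
    rw [this]
    ring

end Midpoint

/-! ### §3. Properness: approximate midpoints, and Menger's theorem -/

section Proper

variable {X : Type*} [MetricSpace X] [ProperSpace X]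

/-- **Approximate midpoints give midpoints in proper spaces**: if for every `ε > 0` some `m` has
`|d(x, m) - d(x,y)/2| ≤ ε` and `|d(m, y) - d(x,y)/2| ≤ ε`, then `x, y` have a midpoint (the
approximate midpoints lie in a compact ball; extract a limit). This is the form in which midpoints
pass to Gromov–Hausdorff limits. [folklore] -/
theorem exists_midpoint_of_forall_approx {x y : X}
    (h : ∀ ε : ℝ, 0 < ε → ∃ m : X, |dist x m - dist x y / 2| ≤ ε ∧ |dist m y - dist x y / 2| ≤ ε) :
    ∃ m : X, dist x m = dist x y / 2 ∧ dist m y = dist x y / 2 := by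
  choose m hm₁ hm₂ using fun n : ℕ ↦ h (1 / ((n : ℝ) + 1)) (by positivity)
  have hle : ∀ n : ℕ, 1 / ((n : ℝ) + 1) ≤ 1 := fun n ↦ by
    rw [div_le_one (by positivity)]
    linarith [Nat.cast_nonneg (α := ℝ) n]
  have hmem : ∀ n, m n ∈ closedBall x (dist x y / 2 + 1) := fun n ↦ by
    have := (abs_le.1 (hm₁ n)).2
    exact mem_closedBall'.2 (by linarith [hle n])
  obtain ⟨m₀, -, φ, hφ, hlim⟩ := (isCompact_closedBall x _).tendsto_subseq hmem
  have hε : Tendsto (fun n ↦ 1 / (((φ n : ℕ) : ℝ) + 1)) atTop (𝓝 0) :=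
    tendsto_one_div_add_atTop_nhds_zero_nat.comp hφ.tendsto_atTop
  have hlo : Tendsto (fun n ↦ dist x y / 2 - 1 / (((φ n : ℕ) : ℝ) + 1)) atTop
      (𝓝 (dist x y / 2)) := by
    simpa using tendsto_const_nhds.sub hε
  have hhi : Tendsto (fun n ↦ dist x y / 2 + 1 / (((φ n : ℕ) : ℝ) + 1)) atTop
      (𝓝 (dist x y / 2)) := by
    simpa using tendsto_const_nhds.add hε
  refine ⟨m₀, ?_, ?_⟩
  · have h1 : Tendsto (fun n ↦ dist x (m (φ n))) atTop (𝓝 (dist x m₀)) :=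
      tendsto_const_nhds.dist hlim
    have h2 : Tendsto (fun n ↦ dist x (m (φ n))) atTop (𝓝 (dist x y / 2)) :=
      tendsto_of_tendsto_of_tendsto_of_le_of_le' hlo hhi
        (Eventually.of_forall fun n ↦ by linarith [(abs_le.1 (hm₁ (φ n))).1])
        (Eventually.of_forall fun n ↦ by linarith [(abs_le.1 (hm₁ (φ n))).2])
    exact tendsto_nhds_unique h1 h2
  · have h1 : Tendsto (fun n ↦ dist (m (φ n)) y) atTop (𝓝 (dist m₀ y)) :=
      hlim.dist tendsto_const_nhds
    have h2 : Tendsto (fun n ↦ dist (m (φ n)) y) atTop (𝓝 (dist x y / 2)) :=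
      tendsto_of_tendsto_of_tendsto_of_le_of_le' hlo hhi
        (Eventually.of_forall fun n ↦ by linarith [(abs_le.1 (hm₂ (φ n))).1])
        (Eventually.of_forall fun n ↦ by linarith [(abs_le.1 (hm₂ (φ n))).2])
    exact tendsto_nhds_unique h1 h2

/-- **Menger's theorem, normalised segment**: in a proper metric space with midpoints, for all
`x, y` there is `σ : ℝ → X` with `σ 0 = x`, `σ 1 = y` and `d(σ s, σ t) = |s - t| d(x, y)` on
`[0, 1]` (dyadic midpoint chains realise the grid distances, `dist_eq_of_chain`; sample
`t ↦ f_i(⌊t 2^i⌋)` and take a limit along an ultrafilter in the compact ball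
`B̄(x, d(x, y))`, which contains every chain point). [cite: ONeill1983, Ch. 5, Prop. 22 and Lemma 24] -/
theorem exists_normalised_segment_of_exists_midpoint
    (hmid : ∀ a b : X, ∃ m, dist a m = dist a b / 2 ∧ dist m b = dist a b / 2) (x y : X) :
    ∃ σ : ℝ → X, σ 0 = x ∧ σ 1 = y ∧
      ∀ s ∈ Icc (0 : ℝ) 1, ∀ t ∈ Icc (0 : ℝ) 1, dist (σ s) (σ t) = |s - t| * dist x y := by
  set d := dist x y with hd
  have hd0 : 0 ≤ d := dist_nonneg
  -- level-`i` chains and their isometry on the grid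
  choose f hf0 hf1 hgap using fun i ↦ exists_midpoint_chain hmid x y i
  have hiso : ∀ i j k, j ≤ 2 ^ i → k ≤ 2 ^ i →
      dist (f i j) (f i k) = |(j : ℝ) - k| / 2 ^ i * d := by
    intro i j k hj hk
    have key : ∀ j k, j ≤ k → k ≤ 2 ^ i → dist (f i j) (f i k) = ((k - j : ℕ) : ℝ) * (d / 2 ^ i) := by
      intro j k hjk hk
      refine dist_eq_of_chain ?_ (hf0 i) (hf1 i) (hgap i) hjk hk
      push_cast
      field_simp
    have hconv : ∀ j k, j ≤ k → ((k - j : ℕ) : ℝ) * (d / 2 ^ i) = |(j : ℝ) - k| / 2 ^ i * d := by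
      intro j k hjk
      rw [abs_sub_comm, abs_of_nonneg (sub_nonneg.2 (by exact_mod_cast hjk)), Nat.cast_sub hjk]
      ring
    rcases le_total j k with hjk | hkj
    · rw [key j k hjk hk, hconv j k hjk]
    · rw [dist_comm, key k j hkj hj, hconv k j hkj, abs_sub_comm]
  -- all chain points lie in the compact ball of radius `d` about `x`
  have hfK : ∀ i k, k ≤ 2 ^ i → f i k ∈ closedBall x d := by
    intro i k hk
    rw [mem_closedBall, dist_comm, ← hf0 i, hiso i 0 k (Nat.zero_le _) hk]
    have h1 : |((0 : ℕ) : ℝ) - k| / 2 ^ i ≤ 1 := by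
      rw [div_le_one (pow_pos two_pos i), Nat.cast_zero, zero_sub, abs_neg, Nat.abs_cast]
      exact_mod_cast hk
    calc |((0 : ℕ) : ℝ) - k| / 2 ^ i * d ≤ 1 * d := by gcongr
      _ = d := one_mul d
  -- the sampled maps `G i t = f i ⌊t 2^i⌋`
  set G : ℕ → ℝ → X := fun i t ↦ f i ⌊t * 2 ^ i⌋₊ with hG
  have hfloor : ∀ i, ∀ t ∈ Icc (0 : ℝ) 1, ⌊t * 2 ^ i⌋₊ ≤ 2 ^ i := by
    intro i t ht
    refine Nat.floor_le_of_le ?_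
    have h1 : t * 2 ^ i ≤ (2 : ℝ) ^ i := mul_le_of_le_one_left (by positivity) ht.2
    exact_mod_cast h1
  have hGK : ∀ i, ∀ t ∈ Icc (0 : ℝ) 1, G i t ∈ closedBall x d := fun i t ht ↦ hfK i _ (hfloor i t ht)
  have hlim : ∀ s ∈ Icc (0 : ℝ) 1, ∀ t ∈ Icc (0 : ℝ) 1,
      Tendsto (fun i ↦ dist (G i s) (G i t)) atTop (𝓝 (|s - t| * d)) := by
    intro s hs t ht
    have heq : ∀ i, dist (G i s) (G i t) = |(⌊s * 2 ^ i⌋₊ : ℝ) - ⌊t * 2 ^ i⌋₊| / 2 ^ i * d :=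
      fun i ↦ hiso i _ _ (hfloor i s hs) (hfloor i t ht)
    simp_rw [heq]
    refine Tendsto.mul_const d ?_
    have h2 : Tendsto (fun i : ℕ ↦ (2 : ℝ) ^ i) atTop atTop :=
      tendsto_pow_atTop_atTop_of_one_lt one_lt_two
    have hs' : Tendsto (fun i : ℕ ↦ (⌊s * 2 ^ i⌋₊ : ℝ) / 2 ^ i) atTop (𝓝 s) :=
      (tendsto_nat_floor_mul_div_atTop hs.1).comp h2
    have ht' : Tendsto (fun i : ℕ ↦ (⌊t * 2 ^ i⌋₊ : ℝ) / 2 ^ i) atTop (𝓝 t) :=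
      (tendsto_nat_floor_mul_div_atTop ht.1).comp h2
    refine ((hs'.sub ht').abs).congr fun i ↦ ?_
    rw [← sub_div, abs_div, abs_of_pos (pow_pos (two_pos : (0 : ℝ) < 2) i)]
  -- limits along an ultrafilter finer than `atTop` exist in the compact ball
  set U : Ultrafilter ℕ := Ultrafilter.of atTop with hU
  have hUle : (U : Filter ℕ) ≤ atTop := Ultrafilter.of_le _
  have hex : ∀ t ∈ Icc (0 : ℝ) 1, ∃ c : X, Tendsto (fun i ↦ G i t) U (𝓝 c) := by
    intro t ht
    have hmem : closedBall x d ∈ ((U.map fun i ↦ G i t : Ultrafilter X) : Filter X) := by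
      rw [Ultrafilter.mem_coe, Ultrafilter.mem_map]
      exact Filter.univ_mem' fun i ↦ hGK i t ht
    obtain ⟨c, -, hc'⟩ := (isCompact_closedBall x d).ultrafilter_le_nhds (U.map fun i ↦ G i t)
      (Filter.le_principal_iff.2 hmem)
    refine ⟨c, ?_⟩
    rw [Ultrafilter.coe_map] at hc'
    exact hc'
  choose σ₀ hσ₀ using hex
  classical
  set σ : ℝ → X := fun t ↦ if ht : t ∈ Icc (0 : ℝ) 1 then σ₀ t ht else x with hσdef
  have hσ : ∀ t (ht : t ∈ Icc (0 : ℝ) 1), Tendsto (fun i ↦ G i t) U (𝓝 (σ t)) := by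
    intro t ht
    simp only [hσdef, dif_pos ht]
    exact hσ₀ t ht
  have hdist : ∀ s ∈ Icc (0 : ℝ) 1, ∀ t ∈ Icc (0 : ℝ) 1, dist (σ s) (σ t) = |s - t| * d := by
    intro s hs t ht
    have h1 : Tendsto (fun i ↦ dist (G i s) (G i t)) U (𝓝 (dist (σ s) (σ t))) :=
      (hσ s hs).dist (hσ t ht)
    exact tendsto_nhds_unique h1 ((hlim s hs t ht).mono_left hUle)
  have h0 : (0 : ℝ) ∈ Icc (0 : ℝ) 1 := ⟨le_rfl, zero_le_one⟩
  have h1 : (1 : ℝ) ∈ Icc (0 : ℝ) 1 := ⟨zero_le_one, le_rfl⟩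
  refine ⟨σ, ?_, ?_, hdist⟩
  · have hx : Tendsto (fun i ↦ G i 0) U (𝓝 x) := by
      have : (fun i ↦ G i 0) = fun _ ↦ x := by
        funext i
        simp [hG, hf0]
      rw [this]
      exact tendsto_const_nhds
    exact tendsto_nhds_unique (hσ 0 h0) hx
  · have hy : Tendsto (fun i ↦ G i 1) U (𝓝 y) := by
      have : (fun i ↦ G i 1) = fun _ ↦ y := by
        funext i
        simp only [hG, one_mul]
        rw [show ((2 : ℝ) ^ i) = ((2 ^ i : ℕ) : ℝ) by norm_cast, Nat.floor_natCast, hf1]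
      rw [this]
      exact tendsto_const_nhds
    exact tendsto_nhds_unique (hσ 1 h1) hy

/-- **Menger's theorem: a proper metric space with midpoints is geodesic** — for all `x, y` there
is a unit-speed minimal segment `σ : ℝ → X`, `σ 0 = x`, `σ (d(x, y)) = y`,
`d(σ s, σ t) = |s - t|` for `s, t ∈ [0, d(x, y)]` (reparametrise the normalised segment; the
constant map if `d(x, y) = 0`). [cite: ONeill1983, Ch. 5, Prop. 22] -/
theorem exists_segment_of_exists_midpoint
    (hmid : ∀ a b : X, ∃ m, dist a m = dist a b / 2 ∧ dist m b = dist a b / 2) (x y : X) :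
    ∃ σ : ℝ → X, σ 0 = x ∧ σ (dist x y) = y ∧
      ∀ s ∈ Icc 0 (dist x y), ∀ t ∈ Icc 0 (dist x y), dist (σ s) (σ t) = |s - t| := by
  set ℓ := dist x y with hℓ
  have hℓ0 : 0 ≤ ℓ := dist_nonneg
  rcases hℓ0.eq_or_lt with hz | hpos
  · have hxy : x = y := dist_eq_zero.1 hz.symm
    refine ⟨fun _ ↦ x, rfl, hxy, fun s hs t ht ↦ ?_⟩
    rw [← hz] at hs ht
    rw [le_antisymm hs.2 hs.1, le_antisymm ht.2 ht.1, sub_self, abs_zero, dist_self]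
  · obtain ⟨σ₁, h0, h1, hσ₁⟩ := exists_normalised_segment_of_exists_midpoint hmid x y
    refine ⟨fun s ↦ σ₁ (s / ℓ), by simp [h0], ?_, fun s hs t ht ↦ ?_⟩
    · show σ₁ (ℓ / ℓ) = y
      rw [div_self hpos.ne', h1]
    · have hmem : ∀ u ∈ Icc (0 : ℝ) ℓ, u / ℓ ∈ Icc (0 : ℝ) 1 := fun u hu ↦
        ⟨div_nonneg hu.1 hℓ0, div_le_one_of_le₀ hu.2 hℓ0⟩
      show dist (σ₁ (s / ℓ)) (σ₁ (t / ℓ)) = |s - t|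
      rw [hσ₁ _ (hmem s hs) _ (hmem t ht), ← hℓ, ← sub_div, abs_div, abs_of_pos hpos,
        div_mul_cancel₀ _ hpos.ne']

end Proper

end Literature.Geometry.MetricGeometry
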